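import Summits.BirchSwinnertonDyer.BirchSwinnertonDyer.Theorems.ResidualThetaTransportAtTwoRlfPrimaryTorsionEigenLevels
import HarnessLib

/-!
# Eigenspaces of an endomorphism of a `p`-primary abelian group with finite `p`-torsion, II: the counting argument and the
# finiteness of the set of integers with an infinite eigenspace (proofs only; part I = `…RlfPrimaryTorsionEigenLevels`)

Route `ResidualThetaTransportAtTwo` (RTT, crux r201, stmt-BirchSwinnertonDyer-23110) / `ThetaPartnerAtTwo`; seat `prover-bsd-wall-tp2-p2x` g12 LEAD
(`--supports stmt-BirchSwinnertonDyer-23110`). PURE ALGEBRA, THEOREMS ONLY (no definition, no named fact, no `sorry`); namespace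
`Summit.BirchSwinnertonDyer.BirchSwinnertonDyer.Theorems.SignedEC.PrimaryTorsionEigen`. The local half of the input `hfinE` of
`TwistedPT.hlevEventual_two_of_plusDualNondeg_of_eigen` (the `u^{N_v}`-eigenclasses of the local factors `Y_v`, `v ∈ S₀`).

Classical fact behind Greenberg's «`𝒫_E^{(v)}(F_∞)` is `Λ`-cotorsion if `v ∤ p`» (LNM 1716, §4 p. 113), in the elementary form
"a `p`-primary abelian group `D` with FINITE `p`-torsion `D[p]` and an additive endomorphism `Φ` has only finitely many integers `w` with
infinite eigenspace `S_w = {y : Φ y = w • y}`" — indeed `p^m ≤ #D[p]` whenever `m` distinct integers have infinite eigenspaces.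
Elementary counting (no structure theory, no duality): `#D[p^k] ≤ #D[p]^k`; an infinite eigenspace meets `D[p^k]` in `≥ p^k` elements
(it contains elements of every order `p^k`); eigenspaces for distinct integers are independent up to a bounded finite error
(`S_{w'} ∩ ∑_{w ∈ L} S_w` is killed by `∏_{w ∈ L} (w' − w) ≠ 0`, and `{y : c • y = 0}` is finite for `c ≠ 0`); hence
`p^{mk} ≤ C · #D[p]^k` for all `k`, forcing `p^m ≤ #D[p]`.

* `finite_torsionBy_pow`, `ncard_torsionBy_pow_le` — `D[p^k]` finite, `#D[p^k] ≤ #D[p]^k`;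
* `finite_setOf_zsmul_eq_zero` — `{y : c • y = 0}` finite for `c ≠ 0`;
* `pow_le_ncard_of_infinite_eigenspaces` — a duplicate-free list of `m` integers with infinite eigenspaces forces `p^m ≤ #D[p]`;
* **`finite_setOf_infinite_eigenspace`** — `{w : ℤ | {y | Φ y = w • y}.Infinite}.Finite`.

References: R. Greenberg, LNM 1716 (1999), §4 p. 113 [GreenbergLNM1716]; R. Greenberg, V. Vatsal, Invent. math. 142 (2000), §2
Prop. (2.4) [GreenbergVatsal2000]; L. Fuchs, *Infinite Abelian Groups* I (1970), §25. [folklore]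
-/

set_option autoImplicit false

noncomputable section

open scoped Classical Pointwise

-- the Theorems namespace of this sub repeats the summit name by design (D-0017 nested layout)
set_option linter.dupNamespace false

namespace Summit.BirchSwinnertonDyer.BirchSwinnertonDyer.Theorems.SignedEC.PrimaryTorsionEigen

variable {D : Type*} [AddCommGroup D] {p : ℕ} [hp : Fact p.Prime] (Φ : D →+ D)

/-! ## §3 Counting -/

omit hp in
/-- An eigenspace `{y : Φ y = w • y}` is closed under natural multiples. [folklore] -/
theorem nsmul_mem_eigenspace {w : ℤ} {y : D} (hy : Φ y = w • y) (j : ℕ) : Φ (j • y) = w • (j • y) := by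
  rw [map_nsmul, hy, smul_comm]

/-- **An infinite eigenspace meets `D[p^k]` in at least `p^k` elements** (it contains an element of order exactly `p^k`).
[folklore] -/
theorem pow_le_ncard_eigenspace_inter (htor : ∀ y : D, ∃ n : ℕ, p ^ n • y = 0) (hfin : {y : D | p • y = 0}.Finite) {w : ℤ}
    (hinf : {y : D | Φ y = w • y}.Infinite) (k : ℕ) :
    p ^ k ≤ ({y : D | Φ y = w • y} ∩ {y : D | p ^ k • y = 0}).ncard := by
  have hfink := (finite_and_ncard_torsionBy_pow_le (p := p) hfin k).1
  rcases Nat.eq_zero_or_pos k with hk0 | hk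
  · subst hk0
    rw [pow_zero]
    exact (Set.ncard_pos (Set.Finite.inter_of_right hfink _)).2 ⟨0, by simp, by simp⟩
  -- an eigenvector outside `D[p^{k-1}]`
  obtain ⟨y, hyS, hyT⟩ : ∃ y ∈ {y : D | Φ y = w • y}, y ∉ {y : D | p ^ (k - 1) • y = 0} := by
    by_contra h
    push Not at h
    exact hinf ((finite_and_ncard_torsionBy_pow_le (p := p) hfin (k - 1)).1.subset h)
  simp only [Set.mem_setOf_eq] at hyS hyT
  -- its order is `p^n` with `n ≥ k`; `z = p^{n-k} • y` has order exactly `p^k`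
  classical
  let n := Nat.find (htor y)
  have hn : p ^ n • y = 0 := Nat.find_spec (htor y)
  have hkn : k ≤ n := by
    by_contra hlt
    push Not at hlt
    have hle : n ≤ k - 1 := by omega
    apply hyT
    obtain ⟨d, hd⟩ := Nat.exists_eq_add_of_le hle
    rw [hd, pow_add, mul_comm, mul_smul, hn, smul_zero]
  set z : D := p ^ (n - k) • y with hz
  have hzS : Φ z = w • z := nsmul_mem_eigenspace Φ hyS _
  have hzk : p ^ k • z = 0 := by
    rw [hz, ← mul_smul, ← pow_add, Nat.add_sub_cancel' hkn, hn]
  have hzk' : ¬ p ^ (k - 1) • z = 0 := by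
    intro h0
    rw [hz, ← mul_smul, ← pow_add] at h0
    have hlt : k - 1 + (n - k) < n := by omega
    exact Nat.find_min (htor y) hlt h0
  have hord : addOrderOf z = p ^ k := by
    obtain ⟨k', rfl⟩ : ∃ k', k = k' + 1 := ⟨k - 1, by omega⟩
    rw [Nat.add_sub_cancel] at hzk'
    exact addOrderOf_eq_prime_pow hzk' hzk
  -- the multiples `j • z`, `j < p^k`, are distinct eigenvectors in `D[p^k]`
  have hsub : (fun j : ℕ ↦ j • z) '' Set.Iio (p ^ k) ⊆ {y : D | Φ y = w • y} ∩ {y : D | p ^ k • y = 0} := by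
    rintro _ ⟨j, -, rfl⟩
    exact ⟨nsmul_mem_eigenspace Φ hzS j, by
      simp only [Set.mem_setOf_eq]; rw [smul_comm, hzk, smul_zero]⟩
  have hinj : Set.InjOn (fun j : ℕ ↦ j • z) (Set.Iio (p ^ k)) := by
    rw [← hord]; exact nsmul_injOn_Iio_addOrderOf
  calc p ^ k = (Set.Iio (p ^ k)).ncard := by rw [← Finset.coe_range, Set.ncard_coe_finset, Finset.card_range]
    _ = ((fun j : ℕ ↦ j • z) '' Set.Iio (p ^ k)).ncard := (hinj.ncard_image).symm
    _ ≤ _ := Set.ncard_le_ncard hsub (Set.Finite.inter_of_right hfink _)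

omit hp in
/-- **Sumset bound**: for finite `X ⊆ H₁`, `Y ⊆ H₂` (subgroups) with `H₁ ∩ H₂ ⊆ K` finite, `#X · #Y ≤ #K · #(X + Y)` — the addition map
`X × Y → X + Y` has fibres of size `≤ #K`. [folklore] -/
theorem ncard_mul_ncard_le_of_inter_subset {X Y K : Set D} (hX : X.Finite) (hY : Y.Finite) (hK : K.Finite)
    {H₁ H₂ : AddSubgroup D} (hXH : X ⊆ H₁) (hYH : Y ⊆ H₂) (hHK : (H₁ : Set D) ∩ H₂ ⊆ K) :
    X.ncard * Y.ncard ≤ K.ncard * (X + Y).ncard := by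
  classical
  set s := hX.toFinset ×ˢ hY.toFinset with hs
  have hfib : ∀ c ∈ s.image (fun q : D × D ↦ q.1 + q.2), (s.filter fun q ↦ q.1 + q.2 = c).card ≤ K.ncard := by
    intro c hc
    rw [Finset.mem_image] at hc
    obtain ⟨⟨x₀, y₀⟩, hq₀, hc₀⟩ := hc
    rw [hs, Finset.mem_product, Set.Finite.mem_toFinset, Set.Finite.mem_toFinset] at hq₀
    -- `(x, y) ↦ x - x₀` injects the fibre into `K`
    have hmap : ∀ q ∈ (s.filter fun q : D × D ↦ q.1 + q.2 = c), q.1 - x₀ ∈ hK.toFinset := by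
      intro q hq
      rw [Finset.mem_filter, hs, Finset.mem_product, Set.Finite.mem_toFinset, Set.Finite.mem_toFinset] at hq
      rw [Set.Finite.mem_toFinset]
      refine hHK ⟨H₁.sub_mem (hXH hq.1.1) (hXH hq₀.1), ?_⟩
      have h : q.1 - x₀ = y₀ - q.2 := by
        have := hq.2.trans hc₀.symm
        rw [sub_eq_sub_iff_add_eq_add, this, add_comm]
      rw [h]
      exact H₂.sub_mem (hYH hq₀.2) (hYH hq.1.2)
    have hinj : Set.InjOn (fun q : D × D ↦ q.1 - x₀) (s.filter fun q : D × D ↦ q.1 + q.2 = c) := by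
      intro q hq q' hq' h
      have h1 : q.1 = q'.1 := sub_left_injective h
      rw [Finset.mem_coe, Finset.mem_filter] at hq hq'
      have h2 : q.2 = q'.2 := by
        have := hq.2.trans hq'.2.symm
        rw [h1] at this
        exact add_left_cancel this
      exact Prod.ext h1 h2
    calc (s.filter fun q ↦ q.1 + q.2 = c).card ≤ hK.toFinset.card := Finset.card_le_card_of_injOn _ hmap hinj
      _ = K.ncard := (Set.ncard_eq_toFinset_card K hK).symm
  have hcard := Finset.card_le_mul_card_image s K.ncard hfib
  have himg : ((s.image fun q : D × D ↦ q.1 + q.2 : Finset D) : Set D) ⊆ X + Y := by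
    intro c hc
    rw [Finset.coe_image] at hc
    obtain ⟨⟨x, y⟩, hq, rfl⟩ := hc
    rw [Finset.mem_coe, hs, Finset.mem_product, Set.Finite.mem_toFinset, Set.Finite.mem_toFinset] at hq
    exact Set.add_mem_add hq.1 hq.2
  have himg' : (s.image fun q : D × D ↦ q.1 + q.2).card ≤ (X + Y).ncard := by
    rw [← Set.ncard_coe_finset]; exact Set.ncard_le_ncard himg (hX.add hY)
  calc X.ncard * Y.ncard = s.card := by
        rw [hs, Finset.card_product, Set.ncard_eq_toFinset_card X hX, Set.ncard_eq_toFinset_card Y hY]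
    _ ≤ K.ncard * (s.image fun q : D × D ↦ q.1 + q.2).card := hcard
    _ ≤ K.ncard * (X + Y).ncard := Nat.mul_le_mul_left _ himg'

omit hp in
/-- The iterated sumset `B_L(k) = ∑_{w ∈ L} (S_w ∩ D[p^k])` lies in `D[p^k]` and in the subgroup `∑_{w ∈ L} S_w`, and is finite.
[folklore] -/
theorem foldr_sumset_subset (hfin : {y : D | p • y = 0}.Finite) (L : List ℤ) (k : ℕ) :
    (L.foldr (fun w (B : Set D) ↦ ({y : D | Φ y = w • y} ∩ {y : D | p ^ k • y = 0}) + B) {0} ⊆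
        {y : D | p ^ k • y = 0}) ∧
      (L.foldr (fun w (B : Set D) ↦ ({y : D | Φ y = w • y} ∩ {y : D | p ^ k • y = 0}) + B) {0} ⊆
        ↑(L.foldr (fun w (H : AddSubgroup D) ↦ (Φ - w • AddMonoidHom.id D).ker ⊔ H) ⊥)) ∧
      (L.foldr (fun w (B : Set D) ↦ ({y : D | Φ y = w • y} ∩ {y : D | p ^ k • y = 0}) + B) {0}).Finite := by
  induction L with
  | nil =>
    simp only [List.foldr_nil]
    exact ⟨by simp, by simp, Set.finite_singleton 0⟩
  | cons w L ih =>
    obtain ⟨h1, h2, h3⟩ := ih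
    simp only [List.foldr_cons]
    refine ⟨?_, ?_, ?_⟩
    · rintro _ ⟨a, ha, b, hb, rfl⟩
      simp only [Set.mem_setOf_eq]
      rw [smul_add, ha.2, h1 hb, add_zero]
    · rintro _ ⟨a, ha, b, hb, rfl⟩
      rw [SetLike.mem_coe, AddSubgroup.mem_sup]
      refine ⟨a, ?_, b, h2 hb, rfl⟩
      rw [AddMonoidHom.mem_ker, AddMonoidHom.sub_apply, AddMonoidHom.smul_apply, AddMonoidHom.id_apply, ha.1, sub_self]
    · exact ((finite_and_ncard_torsionBy_pow_le (p := p) hfin k).1.inter_of_right _).add h3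

/-- **Growth of the iterated sumsets**: for a duplicate-free list `L` of integers all of whose eigenspaces are infinite there is
`C > 0` with `p^{k·|L|} ≤ C · #B_L(k)` for every `k`. [folklore] -/
theorem pow_mul_le_ncard_foldr_sumset (htor : ∀ y : D, ∃ n : ℕ, p ^ n • y = 0) (hfin : {y : D | p • y = 0}.Finite)
    (L : List ℤ) (hL : L.Nodup) (hinf : ∀ w ∈ L, {y : D | Φ y = w • y}.Infinite) :
    ∃ C : ℕ, 0 < C ∧ ∀ k : ℕ, p ^ (k * L.length) ≤
      C * (L.foldr (fun w (B : Set D) ↦ ({y : D | Φ y = w • y} ∩ {y : D | p ^ k • y = 0}) + B) {0}).ncard := by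
  induction L with
  | nil => exact ⟨1, one_pos, fun k ↦ by simp⟩
  | cons w L ih =>
    rw [List.nodup_cons] at hL
    obtain ⟨C, hC, hCk⟩ := ih hL.2 fun v hv ↦ hinf v (List.mem_cons_of_mem _ hv)
    -- the error set `K = {y : c • y = 0}`, `c = ∏_{v ∈ L} (w − v) ≠ 0`
    set c : ℤ := (L.map fun v ↦ w - v).prod with hc
    have hc0 : c ≠ 0 := prod_ne_zero_of_not_mem L hL.1
    have hKfin := finite_setOf_zsmul_eq_zero (p := p) htor hfin hc0
    have hKpos : 0 < {y : D | c • y = 0}.ncard := by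
      rw [Nat.pos_iff_ne_zero, Ne, Set.ncard_eq_zero hKfin]
      exact fun h ↦ (Set.eq_empty_iff_forall_notMem.1 h) 0 (by simp)
    refine ⟨C * {y : D | c • y = 0}.ncard, Nat.mul_pos hC hKpos, fun k ↦ ?_⟩
    obtain ⟨hB1, hB2, hB3⟩ := foldr_sumset_subset Φ hfin L k
    have hXfin : ({y : D | Φ y = w • y} ∩ {y : D | p ^ k • y = 0}).Finite :=
      (finite_and_ncard_torsionBy_pow_le (p := p) hfin k).1.inter_of_right _
    -- `S_w ∩ ∑_{v ∈ L} S_v ⊆ K`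
    have hHK : ((Φ - w • AddMonoidHom.id D).ker : Set D) ∩
        ↑(L.foldr (fun w (H : AddSubgroup D) ↦ (Φ - w • AddMonoidHom.id D).ker ⊔ H) ⊥) ⊆ {y : D | c • y = 0} := by
      rintro y ⟨hy1, hy2⟩
      rw [SetLike.mem_coe, AddMonoidHom.mem_ker, AddMonoidHom.sub_apply, AddMonoidHom.smul_apply, AddMonoidHom.id_apply,
        sub_eq_zero] at hy1
      exact prod_smul_eq_zero_of_eigen_of_mem Φ L hy1 hy2
    have hsum := ncard_mul_ncard_le_of_inter_subset hXfin hB3 hKfin (H₁ := (Φ - w • AddMonoidHom.id D).ker)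
      (fun y hy ↦ by
        rw [SetLike.mem_coe, AddMonoidHom.mem_ker, AddMonoidHom.sub_apply, AddMonoidHom.smul_apply, AddMonoidHom.id_apply,
          hy.1, sub_self]) hB2 hHK
    have hX := pow_le_ncard_eigenspace_inter Φ htor hfin (hinf w List.mem_cons_self) k
    rw [List.length_cons, Nat.mul_succ, pow_add, List.foldr_cons]
    calc p ^ (k * L.length) * p ^ k
        ≤ (C * (L.foldr (fun w (B : Set D) ↦ ({y : D | Φ y = w • y} ∩ {y : D | p ^ k • y = 0}) + B) {0}).ncard) *
            ({y : D | Φ y = w • y} ∩ {y : D | p ^ k • y = 0}).ncard := Nat.mul_le_mul (hCk k) hX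
      _ = C * (({y : D | Φ y = w • y} ∩ {y : D | p ^ k • y = 0}).ncard *
            (L.foldr (fun w (B : Set D) ↦ ({y : D | Φ y = w • y} ∩ {y : D | p ^ k • y = 0}) + B) {0}).ncard) := by ring
      _ ≤ C * ({y : D | c • y = 0}.ncard *
            (({y : D | Φ y = w • y} ∩ {y : D | p ^ k • y = 0}) +
              L.foldr (fun w (B : Set D) ↦ ({y : D | Φ y = w • y} ∩ {y : D | p ^ k • y = 0}) + B) {0}).ncard) :=
          Nat.mul_le_mul_left _ hsum
      _ = _ := by ring

omit hp in
/-- Elementary growth lemma: `a^k ≤ C · b^k` for all `k` forces `a ≤ b`. [folklore] -/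
theorem le_of_pow_le_mul_pow {a b C : ℕ} (h : ∀ k : ℕ, a ^ k ≤ C * b ^ k) : a ≤ b := by
  by_contra hab
  push Not at hab
  have hb1 : b + 1 ≤ a := hab
  -- Bernoulli: `b^{k+1} + (k+1) b^k ≤ (b+1)^{k+1}`
  have bern : ∀ k : ℕ, b ^ (k + 1) + (k + 1) * b ^ k ≤ (b + 1) ^ (k + 1) := by
    intro k
    induction k with
    | zero => simp
    | succ k ih =>
      calc b ^ (k + 2) + (k + 2) * b ^ (k + 1)
          = b * (b ^ (k + 1) + (k + 1) * b ^ k) + b ^ (k + 1) := by ring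
        _ ≤ b * (b + 1) ^ (k + 1) + (b + 1) ^ (k + 1) := by
            have : b ^ (k + 1) ≤ (b + 1) ^ (k + 1) := Nat.pow_le_pow_left (Nat.le_succ b) _
            nlinarith [ih]
        _ = (b + 1) ^ (k + 2) := by ring
  rcases Nat.eq_zero_or_pos b with rfl | hb
  · have := h 1
    rw [zero_pow one_ne_zero, mul_zero, pow_one] at this
    omega
  · -- take `k + 1` with `k = C * b`
    have hk := h (C * b + 1)
    have h1 : (b + 1) ^ (C * b + 1) ≤ a ^ (C * b + 1) := Nat.pow_le_pow_left hb1 _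
    have h2 := bern (C * b)
    -- `b^{Cb+1} + (Cb+1) b^{Cb} ≤ C b^{Cb+1} = C b · b^{Cb}`
    have h3 : b ^ (C * b + 1) + (C * b + 1) * b ^ (C * b) ≤ C * b ^ (C * b + 1) := h2.trans (h1.trans hk)
    have h4 : C * b ^ (C * b + 1) = C * b * b ^ (C * b) := by ring
    rw [h4, pow_succ] at h3
    have hpos : 0 < b ^ (C * b) := Nat.pow_pos hb
    nlinarith

/-- **`m` distinct integers with infinite eigenspaces force `p^m ≤ #D[p]`.** [folklore] -/
theorem pow_le_ncard_of_infinite_eigenspaces (htor : ∀ y : D, ∃ n : ℕ, p ^ n • y = 0) (hfin : {y : D | p • y = 0}.Finite)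
    (L : List ℤ) (hL : L.Nodup) (hinf : ∀ w ∈ L, {y : D | Φ y = w • y}.Infinite) :
    p ^ L.length ≤ {y : D | p • y = 0}.ncard := by
  obtain ⟨C, -, hCk⟩ := pow_mul_le_ncard_foldr_sumset Φ htor hfin L hL hinf
  refine le_of_pow_le_mul_pow (C := C) fun k ↦ ?_
  rw [← pow_mul, mul_comm]
  refine (hCk k).trans (Nat.mul_le_mul_left _ ?_)
  obtain ⟨hB1, -, -⟩ := foldr_sumset_subset Φ hfin L k
  obtain ⟨hTfin, hTcard⟩ := finite_and_ncard_torsionBy_pow_le (p := p) hfin k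
  exact (Set.ncard_le_ncard hB1 hTfin).trans hTcard

/-- **Only finitely many integers have an infinite eigenspace** in a `p`-primary abelian group with finite `p`-torsion, for any additive
endomorphism `Φ` (at most `#D[p]` of them: `p^m ≤ #D[p] < p^{#D[p] + 1}`). The shape of Greenberg's «`𝒫^{(v)}(F_∞)` is
`Λ`-cotorsion for `v ∤ p`» / of «`X/(γ − u)X` finite for all but finitely many `u`» for cofinitely generated discrete modules.
[cite: GreenbergLNM1716, §4 p. 113] -/
theorem finite_setOf_infinite_eigenspace (htor : ∀ y : D, ∃ n : ℕ, p ^ n • y = 0) (hfin : {y : D | p • y = 0}.Finite) :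
    {w : ℤ | {y : D | Φ y = w • y}.Infinite}.Finite := by
  by_contra hinf
  obtain ⟨W, hWsub, hWcard⟩ := Set.Infinite.exists_subset_card_eq (Set.not_finite.1 hinf) ({y : D | p • y = 0}.ncard + 1)
  have hL := pow_le_ncard_of_infinite_eigenspaces Φ htor hfin W.toList W.nodup_toList
    fun w hw ↦ hWsub (Finset.mem_toList.1 hw)
  rw [Finset.length_toList, hWcard] at hL
  have hlt : {y : D | p • y = 0}.ncard + 1 < p ^ ({y : D | p • y = 0}.ncard + 1) := Nat.lt_pow_self hp.out.one_lt
  omega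

end Summit.BirchSwinnertonDyer.BirchSwinnertonDyer.Theorems.SignedEC.PrimaryTorsionEigen

end
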